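import Mathlib
import Summits.Ventures.PercRepro2.OneEdge
import Summits.Ventures.PercRepro2.KPrimeReduction
import Summits.Ventures.PercRepro2.KPrimeBase
import Summits.Ventures.PercRepro2.KPrimeSure
import Summits.Ventures.PercRepro2.KPrimeEdgeSteps
import Summits.Ventures.PercRepro2.KPrimeVEdge

/-!
# The flip dictionary, and the masses of the `v`–`y` edge of the `v`-exploration of `(K′)`
(blind cell PercRepro2, mine-c g35; `conjectures/MINE-C.md` §44.0)

Two tools for resolving an edge `e = {x, y}` from the weight-`1` root of `v` INTO THE MARK `y`
(the theorem is `kprimeHolds_of_update_zero_vy`, `KPrimeVYEdge.lean`):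

* **the flip dictionary** `prob_update_one_eq_update_zero_of_iff`: if, on the weight-`1` edges of
  `p` being open, the event `A` with `e` open is the event `B` with `e` closed, then
  `P_{p[e ↦ 1]}(A) = P_{p[e ↦ 0]}(B)` (the flip-invariance theorem
  `prob_update_one_eq_update_zero` is the case `A = B`);
* **the translations** for `e = {x, y}`, `x` in the root of `v` (`y ↔ v` once `e` is open):
  `S¹ = S ∩ {a₂ ↮ y}`, `N¹ = N ∩ {a₁ ↮ y}`, `(X ∩ N)¹ = X ∩ N ∩ {a₁ ↮ y}`,
  `(U ∩ Ω)¹ = (U ∩ Ω ∩ Yᶜ) ⊔ (0,1)`, `(U ∩ X ∩ Ω)¹ = (U ∩ X ∩ Ω ∩ Yᶜ) ⊔ B̃ ⊔ (0,1)ᵉ` with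
  `B̃ = U ∩ Ω ∩ Yᶜ ∩ Xᶜ ∩ {b ↔ y}`, and the five masses carrying `y ∈ C₁ ∖ C(v)` or `y ∈ C₂` are
  null (`null_masses_vy`); the mass identities `prob_S_vy`, `prob_N_vy`, `prob_XN_vy`,
  `prob_UΩ_vy`, `prob_UXΩ_vy`.
-/

namespace Summit.Ventures.PercRepro2

namespace KPrime

variable {V : Type*} {E : Type*} [Fintype E] [DecidableEq E] [Fintype V] [DecidableEq V]
  {R : Type*} [Field R] [LinearOrder R] [IsStrictOrderedRing R]

section Dictionary

variable {p : E → R} {e : E}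

omit [Fintype V] [DecidableEq V] [IsStrictOrderedRing R] in
/-- **The flip dictionary**: if, on the weight-`1` edges of `p` being open, the event `A` with `e`
open is the event `B` with `e` closed, then the mass of `A` with `e` pinned open is the mass of `B`
with `e` pinned closed (`prob_update_one_eq_update_zero` is the case `A = B`). -/
theorem prob_update_one_eq_update_zero_of_iff (he : p e ≠ 1) {A B : Set (Config E)}
    (hAB : ∀ ω : Config E, oneConfig p ≤ ω →
      (Function.update ω e true ∈ A ↔ Function.update ω e false ∈ B)) :
    prob (Function.update p e 1) A = prob (Function.update p e 0) B := by
  classical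
  have hinv : Function.Involutive (flip e) := flip_flip e
  unfold prob
  have hsum := Equiv.sum_comp hinv.toPerm
    (fun ω => A.indicator (weight (Function.update p e 1)) ω)
  rw [← hsum]
  refine Finset.sum_congr rfl fun ω _ => ?_
  simp only [Function.Involutive.coe_toPerm]
  rw [Set.indicator_apply, Set.indicator_apply, weight_update_one_eq, weight_update_zero_eq,
    weightAway_flip]
  have hfe : flip e ω e = !ω e := by simp [flip]
  by_cases hle : oneConfig p ≤ ω
  · rw [hfe]
    cases hωe : ω e
    · have h1 : flip e ω = Function.update ω e true := by simp [flip, hωe]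
      have h2 : ω = Function.update ω e false := by rw [← hωe, Function.update_eq_self]
      have key : flip e ω ∈ A ↔ ω ∈ B := by
        rw [h1]; conv_rhs => rw [h2]
        exact hAB ω hle
      by_cases hωB : ω ∈ B
      · have h' := key.2 hωB
        simp [hωB, h']
      · have h' : flip e ω ∉ A := fun h => hωB (key.1 h)
        simp [hωB, h']
    · simp
  · rw [weightAway_eq_zero_of_not_le he hle]
    simp

end Dictionary

section StepVY

variable {ends : E → Sym2 V} {a₁ a₂ b v y : V} {p : E → R} {e : E}

omit [Fintype E] [Fintype V] [DecidableEq V] [Field R] [LinearOrder R] [IsStrictOrderedRing R] in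
/-- Opening `e = {x, y}` in a configuration where `v ↔ x`: `s ↔ t` afterwards iff `s ↔ t`, or
`s ↔ v ∧ y ↔ t`, or `s ↔ y ∧ v ↔ t` before. -/
lemma conn_update_true_iff_v {x : V} (hends : ends e = s(x, y)) {ω : Config E}
    (hvx : Conn ends ω v x) (s t : V) :
    Conn ends (Function.update ω e true) s t ↔
      Conn ends ω s t ∨ (Conn ends ω s v ∧ Conn ends ω y t) ∨
        (Conn ends ω s y ∧ Conn ends ω v t) := by
  rw [OneEdge.conn_update_true_iff hends]
  constructor
  · rintro (h | ⟨h1, h2⟩ | ⟨h1, h2⟩)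
    · exact Or.inl h
    · exact Or.inr (Or.inl ⟨conn_trans h1 (conn_symm hvx), h2⟩)
    · exact Or.inr (Or.inr ⟨h1, conn_trans hvx h2⟩)
  · rintro (h | ⟨h1, h2⟩ | ⟨h1, h2⟩)
    · exact Or.inl h
    · exact Or.inr (Or.inl ⟨conn_trans h1 hvx, h2⟩)
    · exact Or.inr (Or.inr ⟨h1, conn_trans (conn_symm hvx) h2⟩)

omit [Fintype E] [Fintype V] [DecidableEq V] [IsStrictOrderedRing R] in
/-- With `e = {x, y}` pinned open and `x` in the root of `v`, `y ↔ v` on the sure set. -/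
lemma conn_y_v_of_mem_sureSet_update_one {x : V} (hends : ends e = s(x, y))
    (hx : x ∈ root p ends v) (he : p e ≠ 1) {ω : Config E}
    (hω : ω ∈ sureSet (Function.update p e 1)) : Conn ends ω y v := by
  have h1 : ω e = true := hω.1 e (by simp)
  have hle : oneConfig p ≤ ω := oneConfig_le_of_mem_sureSet_update he hω
  have hvx : Conn ends ω v x := conn_mono hle hx
  have hxy : Conn ends ω x y := conn_of_openAdj ⟨e, h1, hends⟩
  exact conn_trans (conn_symm hxy) (conn_symm hvx)

omit [Fintype V] [DecidableEq V] [IsStrictOrderedRing R] in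
/-- With `e = {x, y}` pinned open, an event on which `y ↮ v` is null. -/
lemma prob_update_one_eq_zero_of_yv {x : V} (hends : ends e = s(x, y))
    (hx : x ∈ root p ends v) (he : p e ≠ 1) {A : Set (Config E)}
    (hA : ∀ ω ∈ A, ¬ Conn ends ω y v) : prob (Function.update p e 1) A = 0 := by
  apply prob_eq_zero_of_inter_sureSet_eq_empty
  ext ω
  simp only [Set.mem_inter_iff, Set.mem_empty_iff_false, iff_false, not_and]
  intro hωA hω
  exact hA ω hωA (conn_y_v_of_mem_sureSet_update_one hends hx he hω)

/-! ### The translations of the world-`1` events (`e = {x, y}` open) into world-`0` events -/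

omit [Fintype E] [Fintype V] [IsStrictOrderedRing R] in
/-- `S` with `e` open is `S ∩ {a₂ ↮ y}` with `e` closed. -/
lemma S_dict_vy {x : V} (hends : ends e = s(x, y)) (hx : x ∈ root p ends v) (he : p e ≠ 1)
    (ω : Config E) (hle : oneConfig p ≤ ω) :
    Function.update ω e true ∈ S ends a₁ a₂ v ↔
      Function.update ω e false ∈ S ends a₁ a₂ v ∩ (connEvent ends a₂ y)ᶜ := by
  set ω' := Function.update ω e false with hω'
  have hle' : oneConfig p ≤ ω' := oneConfig_le_update_false he hle
  have hvx : Conn ends ω' v x := conn_mono hle' hx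
  have heq : Function.update ω e true = Function.update ω' e true := by
    simp [hω', Function.update_idem]
  rw [heq, Set.mem_inter_iff, Set.mem_compl_iff, mem_connEvent, mem_S, mem_S,
    conn_update_true_iff_v hends hvx, conn_update_true_iff_v hends hvx]
  constructor
  · rintro ⟨h1, h2⟩
    exact ⟨⟨fun h => h1 (Or.inl h), fun h => h2 (Or.inl h)⟩,
      fun h => h2 (Or.inr (Or.inr ⟨h, conn_refl _ _ _⟩))⟩
  · rintro ⟨⟨h1, h2⟩, h3⟩
    refine ⟨?_, ?_⟩
    · rintro (h | ⟨h4, _⟩ | ⟨h4, _⟩)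
      · exact h1 h
      · exact h2 h4
      · exact h3 h4
    · rintro (h | ⟨h4, _⟩ | ⟨h4, _⟩)
      · exact h2 h
      · exact h2 h4
      · exact h3 h4

omit [Fintype E] [Fintype V] [IsStrictOrderedRing R] in
/-- `N` with `e` open is `N ∩ {a₁ ↮ y}` with `e` closed. -/
lemma N_dict_vy {x : V} (hends : ends e = s(x, y)) (hx : x ∈ root p ends v) (he : p e ≠ 1)
    (ω : Config E) (hle : oneConfig p ≤ ω) :
    Function.update ω e true ∈ N ends a₁ a₂ v ↔
      Function.update ω e false ∈ N ends a₁ a₂ v ∩ (connEvent ends a₁ y)ᶜ := by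
  set ω' := Function.update ω e false with hω'
  have hle' : oneConfig p ≤ ω' := oneConfig_le_update_false he hle
  have hvx : Conn ends ω' v x := conn_mono hle' hx
  have heq : Function.update ω e true = Function.update ω' e true := by
    simp [hω', Function.update_idem]
  rw [heq, Set.mem_inter_iff, Set.mem_compl_iff, mem_connEvent, mem_N, mem_N,
    conn_update_true_iff_v hends hvx, conn_update_true_iff_v hends hvx]
  constructor
  · rintro ⟨h1, h2⟩
    exact ⟨⟨fun h => h1 (Or.inl h), fun h => h2 (Or.inl h)⟩,
      fun h => h2 (Or.inr (Or.inr ⟨h, conn_refl _ _ _⟩))⟩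
  · rintro ⟨⟨h1, h2⟩, h3⟩
    refine ⟨?_, ?_⟩
    · rintro (h | ⟨h4, _⟩ | ⟨h4, _⟩)
      · exact h1 h
      · exact h2 h4
      · exact h3 h4
    · rintro (h | ⟨h4, _⟩ | ⟨h4, _⟩)
      · exact h2 h
      · exact h2 h4
      · exact h3 h4

omit [Fintype E] [Fintype V] [IsStrictOrderedRing R] in
/-- `X ∩ N` with `e` open is `X ∩ N ∩ {a₁ ↮ y}` with `e` closed. -/
lemma XN_dict_vy {x : V} (hends : ends e = s(x, y)) (hx : x ∈ root p ends v) (he : p e ≠ 1)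
    (ω : Config E) (hle : oneConfig p ≤ ω) :
    Function.update ω e true ∈ connEvent ends a₁ b ∩ N ends a₁ a₂ v ↔
      Function.update ω e false ∈
        connEvent ends a₁ b ∩ N ends a₁ a₂ v ∩ (connEvent ends a₁ y)ᶜ := by
  have hN := N_dict_vy (a₁ := a₁) (a₂ := a₂) hends hx he ω hle
  set ω' := Function.update ω e false with hω'
  have hle' : oneConfig p ≤ ω' := oneConfig_le_update_false he hle
  have hvx : Conn ends ω' v x := conn_mono hle' hx
  have heq : Function.update ω e true = Function.update ω' e true := by
    simp [hω', Function.update_idem]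
  rw [heq] at hN ⊢
  rw [Set.mem_inter_iff, Set.mem_inter_iff, hN, Set.mem_inter_iff, Set.mem_inter_iff,
    Set.mem_compl_iff, mem_connEvent, mem_connEvent, mem_connEvent, mem_N,
    conn_update_true_iff_v hends hvx]
  constructor
  · rintro ⟨hb, ⟨hN', hy⟩⟩
    refine ⟨⟨?_, hN'⟩, hy⟩
    rcases hb with h | ⟨h1, _⟩ | ⟨h1, _⟩
    · exact h
    · exact absurd h1 hN'.2
    · exact absurd h1 hy
  · rintro ⟨⟨hb, hN'⟩, hy⟩
    exact ⟨Or.inl hb, hN', hy⟩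

omit [Fintype E] [Fintype V] [IsStrictOrderedRing R] in
/-- `U ∩ Ω` with `e` open is `(U ∩ Ω ∩ Yᶜ) ∪ (0,1)` with `e` closed. -/
lemma UΩ_dict_vy {x : V} (hends : ends e = s(x, y)) (hx : x ∈ root p ends v) (he : p e ≠ 1)
    (ω : Config E) (hle : oneConfig p ≤ ω) :
    Function.update ω e true ∈ connEvent ends a₁ v ∩ Ω ends a₁ a₂ ↔
      Function.update ω e false ∈
        (connEvent ends a₁ v ∩ Ω ends a₁ a₂ ∩ (connEvent ends a₂ y)ᶜ) ∪
          cls01 ends a₁ a₂ v y := by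
  set ω' := Function.update ω e false with hω'
  have hle' : oneConfig p ≤ ω' := oneConfig_le_update_false he hle
  have hvx : Conn ends ω' v x := conn_mono hle' hx
  have heq : Function.update ω e true = Function.update ω' e true := by
    simp [hω', Function.update_idem]
  rw [heq]
  simp only [cls01, Set.mem_union, Set.mem_inter_iff, Set.mem_compl_iff, mem_connEvent, mem_Ω,
    mem_S, conn_update_true_iff_v hends hvx]
  constructor
  · rintro ⟨hU, hΩ⟩
    have ha : ¬ Conn ends ω' a₁ a₂ := fun h => hΩ (Or.inl h)
    by_cases huv : Conn ends ω' a₁ v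
    · left
      exact ⟨⟨huv, ha⟩, fun h => hΩ (Or.inr (Or.inl ⟨huv, conn_symm h⟩))⟩
    · right
      have huy : Conn ends ω' a₁ y := by
        rcases hU with h | ⟨h1, _⟩ | ⟨h1, _⟩
        · exact absurd h huv
        · exact absurd h1 huv
        · exact h1
      refine ⟨⟨huv, huy⟩, fun h => ha (conn_symm h), fun h => hΩ (Or.inr (Or.inr ⟨huy, conn_symm h⟩))⟩
  · rintro (⟨⟨huv, ha⟩, hy⟩ | ⟨⟨huv, huy⟩, ha, hv⟩)
    · refine ⟨Or.inl huv, ?_⟩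
      rintro (h | ⟨_, h2⟩ | ⟨_, h2⟩)
      · exact ha h
      · exact hy (conn_symm h2)
      · exact ha (conn_trans huv h2)
    · refine ⟨Or.inr (Or.inr ⟨huy, conn_refl _ _ _⟩), ?_⟩
      rintro (h | ⟨h1, _⟩ | ⟨_, h2⟩)
      · exact ha (conn_symm h)
      · exact huv h1
      · exact hv (conn_symm h2)

omit [Fintype E] [Fintype V] [IsStrictOrderedRing R] in
/-- `U ∩ X ∩ Ω` with `e` open is `(U ∩ X ∩ Ω ∩ Yᶜ) ∪ B̃ ∪ (0,1)ᵉ` with `e` closed, where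
`B̃ = U ∩ Ω ∩ Yᶜ ∩ Xᶜ ∩ {b ↔ y}`. -/
lemma UXΩ_dict_vy {x : V} (hends : ends e = s(x, y)) (hx : x ∈ root p ends v) (he : p e ≠ 1)
    (ω : Config E) (hle : oneConfig p ≤ ω) :
    Function.update ω e true ∈ connEvent ends a₁ v ∩ connEvent ends a₁ b ∩ Ω ends a₁ a₂ ↔
      Function.update ω e false ∈
        (connEvent ends a₁ v ∩ connEvent ends a₁ b ∩ Ω ends a₁ a₂ ∩ (connEvent ends a₂ y)ᶜ) ∪
          (connEvent ends a₁ v ∩ Ω ends a₁ a₂ ∩ (connEvent ends a₂ y)ᶜ ∩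
            (connEvent ends a₁ b)ᶜ ∩ connEvent ends b y) ∪
          cls01e ends a₁ a₂ b v y := by
  set ω' := Function.update ω e false with hω'
  have hle' : oneConfig p ≤ ω' := oneConfig_le_update_false he hle
  have hvx : Conn ends ω' v x := conn_mono hle' hx
  have heq : Function.update ω e true = Function.update ω' e true := by
    simp [hω', Function.update_idem]
  rw [heq]
  simp only [cls01e, Set.mem_union, Set.mem_inter_iff, Set.mem_compl_iff, mem_connEvent, mem_Ω,
    mem_S, conn_update_true_iff_v hends hvx]
  constructor
  · rintro ⟨⟨hU, hX⟩, hΩ⟩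
    have ha : ¬ Conn ends ω' a₁ a₂ := fun h => hΩ (Or.inl h)
    by_cases huv : Conn ends ω' a₁ v
    · have hy : ¬ Conn ends ω' a₂ y := fun h => hΩ (Or.inr (Or.inl ⟨huv, conn_symm h⟩))
      by_cases hb : Conn ends ω' a₁ b
      · exact Or.inl (Or.inl ⟨⟨⟨huv, hb⟩, ha⟩, hy⟩)
      · refine Or.inl (Or.inr ⟨⟨⟨⟨huv, ha⟩, hy⟩, hb⟩, ?_⟩)
        rcases hX with h | ⟨_, h2⟩ | ⟨_, h2⟩
        · exact absurd h hb
        · exact conn_symm h2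
        · exact absurd (conn_trans huv h2) hb
    · right
      have huy : Conn ends ω' a₁ y := by
        rcases hU with h | ⟨h1, _⟩ | ⟨h1, _⟩
        · exact absurd h huv
        · exact absurd h1 huv
        · exact h1
      refine ⟨⟨⟨huv, huy⟩, fun h => ha (conn_symm h),
        fun h => hΩ (Or.inr (Or.inr ⟨huy, conn_symm h⟩))⟩, ?_⟩
      rcases hX with h | ⟨h1, _⟩ | ⟨_, h2⟩
      · exact Or.inl h
      · exact absurd h1 huv
      · exact Or.inr h2
  · rintro ((⟨⟨⟨huv, hb⟩, ha⟩, hy⟩ | ⟨⟨⟨⟨huv, ha⟩, hy⟩, hb⟩, hby⟩) | ⟨⟨⟨huv, huy⟩, ha, hv⟩, hX⟩)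
    · refine ⟨⟨Or.inl huv, Or.inl hb⟩, ?_⟩
      rintro (h | ⟨_, h2⟩ | ⟨_, h2⟩)
      · exact ha h
      · exact hy (conn_symm h2)
      · exact ha (conn_trans huv h2)
    · refine ⟨⟨Or.inl huv, Or.inr (Or.inl ⟨huv, conn_symm hby⟩)⟩, ?_⟩
      rintro (h | ⟨_, h2⟩ | ⟨_, h2⟩)
      · exact ha h
      · exact hy (conn_symm h2)
      · exact ha (conn_trans huv h2)
    · refine ⟨⟨Or.inr (Or.inr ⟨huy, conn_refl _ _ _⟩), ?_⟩, ?_⟩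
      · rcases hX with h | h
        · exact Or.inl h
        · exact Or.inr (Or.inr ⟨huy, h⟩)
      · rintro (h | ⟨h1, _⟩ | ⟨_, h2⟩)
        · exact ha (conn_symm h)
        · exact huv h1
        · exact hv (conn_symm h2)

/-! ### The masses with `e` pinned open, as world-`0` masses -/

omit [Fintype V] [IsStrictOrderedRing R] in
/-- `P¹(S) = P⁰(S ∩ Yᶜ)`. -/
lemma prob_S_vy {x : V} (hends : ends e = s(x, y)) (hx : x ∈ root p ends v) (he : p e ≠ 1) :
    prob (Function.update p e 1) (S ends a₁ a₂ v) =
      prob (Function.update p e 0) (S ends a₁ a₂ v ∩ (connEvent ends a₂ y)ᶜ) :=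
  prob_update_one_eq_update_zero_of_iff he (S_dict_vy hends hx he)

omit [Fintype V] [IsStrictOrderedRing R] in
/-- `P¹(N) = P⁰(N ∩ {a₁ ↮ y})`. -/
lemma prob_N_vy {x : V} (hends : ends e = s(x, y)) (hx : x ∈ root p ends v) (he : p e ≠ 1) :
    prob (Function.update p e 1) (N ends a₁ a₂ v) =
      prob (Function.update p e 0) (N ends a₁ a₂ v ∩ (connEvent ends a₁ y)ᶜ) :=
  prob_update_one_eq_update_zero_of_iff he (N_dict_vy hends hx he)

omit [Fintype V] [IsStrictOrderedRing R] in
/-- `P¹(X ∩ N) = P⁰(X ∩ N ∩ {a₁ ↮ y})`. -/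
lemma prob_XN_vy {x : V} (hends : ends e = s(x, y)) (hx : x ∈ root p ends v) (he : p e ≠ 1) :
    prob (Function.update p e 1) (connEvent ends a₁ b ∩ N ends a₁ a₂ v) =
      prob (Function.update p e 0)
        (connEvent ends a₁ b ∩ N ends a₁ a₂ v ∩ (connEvent ends a₁ y)ᶜ) :=
  prob_update_one_eq_update_zero_of_iff he (XN_dict_vy hends hx he)

omit [Fintype V] [IsStrictOrderedRing R] in
/-- `P¹(U ∩ Ω) = P⁰(U ∩ Ω ∩ Yᶜ) + P⁰((0,1))`. -/
lemma prob_UΩ_vy {x : V} (hends : ends e = s(x, y)) (hx : x ∈ root p ends v) (he : p e ≠ 1) :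
    prob (Function.update p e 1) (connEvent ends a₁ v ∩ Ω ends a₁ a₂) =
      prob (Function.update p e 0)
          (connEvent ends a₁ v ∩ Ω ends a₁ a₂ ∩ (connEvent ends a₂ y)ᶜ) +
        prob (Function.update p e 0) (cls01 ends a₁ a₂ v y) := by
  rw [prob_update_one_eq_update_zero_of_iff he (UΩ_dict_vy hends hx he)]
  apply prob_union_of_disjoint
  exact Set.disjoint_left.2 fun ω h1 h2 => h2.1.1 h1.1.1

omit [Fintype V] [IsStrictOrderedRing R] in
/-- `P¹(U ∩ X ∩ Ω) = P⁰(U ∩ X ∩ Ω ∩ Yᶜ) + P⁰(B̃) + P⁰((0,1)ᵉ)`. -/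
lemma prob_UXΩ_vy {x : V} (hends : ends e = s(x, y)) (hx : x ∈ root p ends v) (he : p e ≠ 1) :
    prob (Function.update p e 1) (connEvent ends a₁ v ∩ connEvent ends a₁ b ∩ Ω ends a₁ a₂) =
      prob (Function.update p e 0)
          (connEvent ends a₁ v ∩ connEvent ends a₁ b ∩ Ω ends a₁ a₂ ∩ (connEvent ends a₂ y)ᶜ) +
        prob (Function.update p e 0)
          (connEvent ends a₁ v ∩ Ω ends a₁ a₂ ∩ (connEvent ends a₂ y)ᶜ ∩
            (connEvent ends a₁ b)ᶜ ∩ connEvent ends b y) +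
        prob (Function.update p e 0) (cls01e ends a₁ a₂ b v y) := by
  rw [prob_update_one_eq_update_zero_of_iff he (UXΩ_dict_vy hends hx he),
    prob_union_of_disjoint, prob_union_of_disjoint]
  · exact Set.disjoint_left.2 fun ω h1 h2 => h2.1.2 h1.1.1.2
  · exact Set.disjoint_left.2 fun ω h1 h2 =>
      h2.1.1.1 (h1.elim (fun h => h.1.1.1) (fun h => h.1.1.1.1))

omit [Fintype V] [IsStrictOrderedRing R] in
/-- With `e` pinned open the five masses carrying `y ∈ C₁ ∖ C(v)` or `y ∈ C₂` are null. -/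
lemma null_masses_vy {x : V} (hends : ends e = s(x, y)) (hx : x ∈ root p ends v)
    (he : p e ≠ 1) :
    prob (Function.update p e 1) (connEvent ends a₂ y ∩ S ends a₁ a₂ v) = 0 ∧
    prob (Function.update p e 1) (cls01e ends a₁ a₂ b v y) = 0 ∧
    prob (Function.update p e 1) (cls01 ends a₁ a₂ v y) = 0 ∧
    prob (Function.update p e 1)
      (connEvent ends a₁ v ∩ connEvent ends a₂ y ∩ connEvent ends a₁ b ∩ Ω ends a₁ a₂) = 0 ∧
    prob (Function.update p e 1) (connEvent ends a₁ v ∩ connEvent ends a₂ y ∩ Ω ends a₁ a₂) = 0 := by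
  refine ⟨?_, ?_, ?_, ?_, ?_⟩
  · exact prob_update_one_eq_zero_of_yv hends hx he fun ω ⟨hy, hS⟩ hyv =>
      (mem_S.1 hS).2 (conn_trans hy hyv)
  · exact prob_update_one_eq_zero_of_yv hends hx he fun ω ⟨⟨⟨hnu, hw⟩, _⟩, _⟩ hyv =>
      hnu (conn_trans hw hyv)
  · exact prob_update_one_eq_zero_of_yv hends hx he fun ω ⟨⟨hnu, hw⟩, _⟩ hyv =>
      hnu (conn_trans hw hyv)
  · exact prob_update_one_eq_zero_of_yv hends hx he fun ω ⟨⟨⟨hu, hy⟩, _⟩, hΩ⟩ hyv =>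
      (mem_Ω.1 hΩ) (conn_trans hu (conn_trans (conn_symm hyv) (conn_symm hy)))
  · exact prob_update_one_eq_zero_of_yv hends hx he fun ω ⟨⟨hu, hy⟩, hΩ⟩ hyv =>
      (mem_Ω.1 hΩ) (conn_trans hu (conn_trans (conn_symm hyv) (conn_symm hy)))

end StepVY

end KPrime

end Summit.Ventures.PercRepro2
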